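import Literature.AlgebraicGeometry.Motives.ConjugateTupleVariety
import Literature.RingTheory.KrullDimension.FibreInequality
import HarnessLib

/-!
# The dimension count for linearly rigid tuples: `r n² + 1 ≤ n² + (n² + Σᵢ dim C(Tᵢ))`

Topic `Literature/AlgebraicGeometry/Motives`, continuing `ConjugateTupleVariety.lean` (coordinate
rings `K[x]` of `M_n^r` and `K[d, z]` of `M_n × ∏ᵢ C(Tᵢ)`, comorphism `φ* : Xᵢ ↦ D Zᵢ`).  This is the
algebraic-geometry half of "linearly rigid ⟹ index of rigidity `2`" ([StrambachVolklein1999];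
[Haraoka2020, Thm. 7.8, third part]: "if `ρ` is rigid, `G = SL(n) × ∏ Z(Mᵢ)` acts transitively on
`π⁻¹(I)` … `dim G ≥ dim π⁻¹(I) = (p+1)n² - (n²-1)`"), carried out with prime ideals instead of
varieties and WITHOUT localising: let `P = ker φ* ⊆ K[x]` (a prime, `K[d, z]` being a domain).

* `ker_comorph_le` — **rigidity enters here**: if every tuple `(Cᵢ)` in `GL_n(K)` with
  `∏ᵢ Cᵢ Tᵢ Cᵢ⁻¹ = 1` is of the form `(D₀ Wᵢ)`, `Wᵢ ∈ C(Tᵢ)` (linear rigidity in matrix form, a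
  hypothesis `hrig` of this file, supplied from `IsLinearlyRigid` in `LinearlyRigidIndexTwo.lean`),
  then `P ⊆ P'` for every prime `P'` containing the fibre equations and not containing
  `f = ∏ det Xᵢ`: for `a ∈ P`, `f a` vanishes on all `K`-points of `V(P')` (at a point with
  `f ≠ 0` the equations say `∏ Cᵢ Tᵢ Cᵢ⁻¹ = 1` — `prod_pointMatrix_eq_smul`, using `det M = fⁿ`
  and a Laplace expansion, `eq_smul_one_of_det_eq_pow` — so the point is `(D₀ Wᵢ) = φ(D₀, W)` and
  `a(φ(D₀, W)) = (φ* a)(D₀, W) = 0`), hence `f a ∈ P'` by Hilbert's Nullstellensatz (Mathlib's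
  `MvPolynomial.IsPrime.vanishingIdeal_zeroLocus`) and `a ∈ P'`;
* `ker_comorph_mem_minimalPrimes` — so `P` is a minimal prime of the ideal of the `n² - 1` fibre
  equations (`f ∉ P`);
* `dim_count` — Krull's height theorem (Mathlib
  `Ideal.height_le_card_of_mem_minimalPrimes_span_finset`) gives `ht P ≤ n² - 1`; the dimension formula for the affine domain `K[x]`
  (`Literature.RingTheory.KrullDimension.ringKrullDim_quotient_add_height`) gives
  `dim K[x]/P = r n² - ht P`; and `K[x]/P ↪ K[d, z]` gives `dim K[x]/P ≤ n² + Σᵢ cᵢ`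
  (`Literature.RingTheory.KrullDimension.ringKrullDim_le_of_injective`).  Hence
  `r n² + 1 ≤ n² + (n² + Σᵢ dim C(Tᵢ))`, i.e. `rig(T) = Σᵢ dim C(Tᵢ) - (r - 2) n² ≥ 1`.

## References
* [Haraoka2020] proof of Thm. 7.8 (pp. 153–154); [StrambachVolklein1999]; H. Matsumura,
  *Commutative Ring Theory*, Thm. 5.6, 13.5 (dimension theory used through the tree files
  `Literature/RingTheory/KrullDimension/`).
-/

noncomputable section

namespace Literature.AlgebraicGeometry.Motives

namespace RigidTuple

open MvPolynomial Matrix Module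

universe u

variable {K : Type u} [Field K] {r n : ℕ} (T : Fin r → Matrix (Fin n) (Fin n) K)

/-! ### `K`-points of `M_n^r` -/

/-- `Xᵢ(x) = Cᵢ`. [folklore] -/
theorem eval_genMatrix (x : TupleVars r n → K) (i : Fin r) :
    (genMatrix K r n i).map (eval x) = pointMatrix x i := by
  ext j k
  simp [genMatrix, pointMatrix]

/-- `f(x) = ∏ᵢ det Cᵢ`. [folklore] -/
theorem eval_detProd (x : TupleVars r n → K) :
    eval x (detProd K r n) = ∏ i, (pointMatrix x i).det := by
  unfold detProd
  rw [map_prod]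
  refine Finset.prod_congr rfl fun i _ => ?_
  rw [RingHom.map_det, RingHom.mapMatrix_apply, eval_genMatrix]

/-- `M(x) = ∏ᵢ Cᵢ Tᵢ adj(Cᵢ)`. [folklore] -/
theorem eval_prodMatrix (x : TupleVars r n → K) :
    (prodMatrix T).map (eval x) =
      (List.ofFn fun i => pointMatrix x i * T i * (pointMatrix x i).adjugate).prod := by
  unfold prodMatrix
  have h := map_list_prod ((eval x).mapMatrix :
      Matrix (Fin n) (Fin n) (TuplePoly K r n) →+* Matrix (Fin n) (Fin n) K)
    (List.ofFn fun i => genMatrix K r n i * (T i).map C * (genMatrix K r n i).adjugate)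
  rw [RingHom.mapMatrix_apply, List.map_ofFn] at h
  refine h.trans ?_
  congr 1
  refine List.ofFn_inj.2 (funext fun i => ?_)
  have hadj := RingHom.map_adjugate (eval x) (genMatrix K r n i)
  rw [RingHom.mapMatrix_apply, RingHom.mapMatrix_apply, eval_genMatrix] at hadj
  have hT : ((T i).map (C : K →+* TuplePoly K r n)).map (eval x) = T i := by
    ext j k
    simp
  simp only [Function.comp_apply, map_mul, RingHom.mapMatrix_apply, eval_genMatrix, hadj, hT]

/-! ### Dimensions of the two polynomial rings -/

/-- `dim K[x] = r n²`. [folklore] -/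
theorem ringKrullDim_tuplePoly :
    ringKrullDim (TuplePoly K r n) = (r * (n * n) : ℕ) := by
  rw [MvPolynomial.ringKrullDim_of_isNoetherianRing, ringKrullDim_eq_zero_of_field,
    Nat.card_eq_fintype_card, Fintype.card_prod, Fintype.card_prod, Fintype.card_fin,
    Fintype.card_fin, zero_add]

/-- `dim K[d, z] = n² + Σᵢ dim C(Tᵢ)`. [folklore] -/
theorem ringKrullDim_groupPoly :
    ringKrullDim (GroupPoly T) = (n * n + ∑ i, cdim T i : ℕ) := by
  rw [MvPolynomial.ringKrullDim_of_isNoetherianRing, ringKrullDim_eq_zero_of_field,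
    Nat.card_eq_fintype_card, Fintype.card_sum, Fintype.card_prod, Fintype.card_fin,
    Fintype.card_sigma, zero_add]
  simp only [Fintype.card_fin]


/-! ### A determinant lemma -/

/-- A matrix which agrees with `c • 1` off one diagonal entry `(e, e)` and has determinant `cⁿ`,
`c ≠ 0`, is `c • 1` (expand the determinant along the row `e`). [folklore] -/
theorem eq_smul_one_of_det_eq_pow {c : K} (hc : c ≠ 0) (N : Matrix (Fin n) (Fin n) K)
    (e : Fin n)
    (hN : ∀ j k, (j, k) ≠ (e, e) → N j k = (c • (1 : Matrix (Fin n) (Fin n) K)) j k)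
    (hdet : N.det = c ^ n) : N = c • (1 : Matrix (Fin n) (Fin n) K) := by
  obtain ⟨m, rfl⟩ : ∃ m, n = m + 1 := ⟨n - 1, (Nat.succ_pred_eq_of_pos e.pos).symm⟩
  -- Laplace expansion along the row `e`
  have hlap := Matrix.det_succ_row N e
  rw [Finset.sum_eq_single e, ← two_mul, pow_mul, neg_one_sq, one_pow, one_mul] at hlap
  · -- the minor is `c • 1`
    have hminor : N.submatrix e.succAbove e.succAbove = c • (1 : Matrix (Fin m) (Fin m) K) := by
      ext a b
      rw [Matrix.submatrix_apply, hN _ _ (fun h => Fin.succAbove_ne e a (Prod.mk.inj h).1)]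
      simp only [Matrix.smul_apply, Matrix.one_apply, Fin.succAbove_right_inj]
    rw [hminor, Matrix.det_smul, Matrix.det_one, mul_one, Fintype.card_fin] at hlap
    -- `hlap : det N = N e e * c ^ m`, `hdet : det N = c ^ (m + 1)`
    have hee : N e e = c := by
      have h2 : N e e * c ^ m = c * c ^ m := by rw [← hlap, hdet, pow_succ, mul_comm]
      exact mul_right_cancel₀ (pow_ne_zero m hc) h2
    ext j k
    by_cases hjk : (j, k) = (e, e)
    · obtain ⟨rfl, rfl⟩ := Prod.mk.inj hjk
      rw [hee]
      simp
    · exact hN j k hjk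
  · intro k _ hke
    rw [hN e k (fun h => hke (Prod.mk.inj h).2)]
    simp [Ne.symm hke]
  · intro h
    exact absurd (Finset.mem_univ e) h


/-! ### Points of the fibre -/

/-- `det (∏ᵢ Cᵢ Tᵢ adj Cᵢ) = (∏ᵢ det Cᵢ)ⁿ` when `∏ᵢ Tᵢ = 1`. [folklore] -/
theorem det_prod_mul_adjugate (hT : (List.ofFn T).prod = 1) (e : Fin n)
    (C : Fin r → Matrix (Fin n) (Fin n) K) :
    ((List.ofFn fun i => C i * T i * (C i).adjugate).prod).det = (∏ i, (C i).det) ^ n := by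
  obtain ⟨m, rfl⟩ : ∃ m, n = m + 1 := ⟨n - 1, (Nat.succ_pred_eq_of_pos e.pos).symm⟩
  have hdetT : ∏ i, (T i).det = 1 := by
    have h := map_list_prod (Matrix.detMonoidHom : Matrix (Fin (m + 1)) (Fin (m + 1)) K →* K)
      (List.ofFn T)
    rw [hT, map_one, List.map_ofFn, List.prod_ofFn] at h
    simpa using h.symm
  have h := map_list_prod (Matrix.detMonoidHom : Matrix (Fin (m + 1)) (Fin (m + 1)) K →* K)
    (List.ofFn fun i => C i * T i * (C i).adjugate)
  rw [List.map_ofFn, List.prod_ofFn] at h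
  simp only [Matrix.coe_detMonoidHom, Function.comp_apply] at h
  rw [h]
  simp only [Matrix.det_mul, Matrix.det_adjugate, Fintype.card_fin, Nat.add_sub_cancel]
  rw [Finset.prod_mul_distrib, Finset.prod_mul_distrib, hdetT, mul_one, ← Finset.prod_mul_distrib,
    ← Finset.prod_pow]
  refine Finset.prod_congr rfl fun i _ => ?_
  ring

/-- A `K`-point `x = (Cᵢ)` of `M_n^r` at which the equations `fibreGens` vanish and `f = ∏ det Cᵢ`
does not satisfies `∏ᵢ Cᵢ Tᵢ adj(Cᵢ) = f(x) • 1`, i.e. `∏ᵢ Cᵢ Tᵢ Cᵢ⁻¹ = 1`. [folklore] -/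
theorem prod_pointMatrix_eq_smul [DecidableEq (TuplePoly K r n)]
    (hT : (List.ofFn T).prod = 1) (e : Fin n) (x : TupleVars r n → K)
    (hx : ∀ g ∈ fibreGens T e, eval x g = 0)
    (hf : eval x (detProd K r n) ≠ 0) :
    (List.ofFn fun i => pointMatrix x i * T i * (pointMatrix x i).adjugate).prod =
      (∏ i, (pointMatrix x i).det) • (1 : Matrix (Fin n) (Fin n) K) := by
  rw [eval_detProd] at hf
  refine eq_smul_one_of_det_eq_pow hf _ e (fun j k hjk => ?_) (det_prod_mul_adjugate T hT e _)
  have hg : prodMatrix T j k - detProd K r n * (1 : Matrix (Fin n) (Fin n) (TuplePoly K r n)) j k ∈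
      fibreGens T e := by
    rw [fibreGens, Finset.mem_image]
    exact ⟨(j, k), Finset.mem_erase.2 ⟨hjk, Finset.mem_univ _⟩, rfl⟩
  have h0 := hx _ hg
  rw [map_sub, map_mul, sub_eq_zero, eval_detProd] at h0
  have hN := congrFun (congrFun (eval_prodMatrix T x) j) k
  rw [Matrix.map_apply] at hN
  rw [← hN, h0, Matrix.smul_apply, smul_eq_mul, Matrix.one_apply, Matrix.one_apply]
  split_ifs <;> simp

/-! ### The kernel of `φ*` is the minimal prime of the fibre -/

section Rigid

variable [IsAlgClosed K]

/- Matrix form of linear rigidity: every tuple `(Cᵢ)` in `GL_n(K)` with `∏ᵢ Cᵢ Tᵢ Cᵢ⁻¹ = 1`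
(written `∏ᵢ Cᵢ Tᵢ adj Cᵢ = (∏ det Cᵢ) • 1`) is of the form `Cᵢ = D₀ Wᵢ` with `Wᵢ ∈ C(Tᵢ)`. -/
variable (hrig : ∀ C : Fin r → Matrix (Fin n) (Fin n) K, (∀ i, (C i).det ≠ 0) →
    (List.ofFn fun i => C i * T i * (C i).adjugate).prod =
      (∏ i, (C i).det) • (1 : Matrix (Fin n) (Fin n) K) →
    ∃ (D₀ : Matrix (Fin n) (Fin n) K)
      (W : ∀ i, Subalgebra.centralizer K ({T i} : Set (Matrix (Fin n) (Fin n) K))),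
      ∀ i, C i = D₀ * (W i : Matrix (Fin n) (Fin n) K))

include hrig in
/-- **Rigidity ⟹ `ker φ*` lies in every prime of the fibre not containing `f`**: for a prime
`P' ⊇ (fibreGens)` with `f ∉ P'` and `a ∈ ker φ*`, the product `f a` vanishes at every `K`-point of
`V(P')` — where `f ≠ 0` the point is a tuple `(Cᵢ)` with `∏ Cᵢ Tᵢ Cᵢ⁻¹ = 1`, hence `= (D₀ Wᵢ)` by
rigidity, and `a(D₀ W) = (φ* a)(D₀, W) = 0` — so `f a ∈ P'` by the Nullstellensatz, and `a ∈ P'`.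
[folklore] -/
theorem ker_comorph_le [DecidableEq (TuplePoly K r n)] (hT : (List.ofFn T).prod = 1)
    (e : Fin n)    {P' : Ideal (TuplePoly K r n)} [hP' : P'.IsPrime]
    (hJ : Ideal.span (fibreGens T e : Set (TuplePoly K r n)) ≤ P') (hf : detProd K r n ∉ P') :
    RingHom.ker (comorph T) ≤ P' := by
  intro a ha
  rw [RingHom.mem_ker] at ha
  have hfa : detProd K r n * a ∈ P' := by
    rw [← MvPolynomial.IsPrime.vanishingIdeal_zeroLocus (K := K) P',
      MvPolynomial.mem_vanishingIdeal_iff]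
    intro x hx
    rw [MvPolynomial.mem_zeroLocus_iff] at hx
    have hx' : ∀ p ∈ P', eval x p = 0 := fun p hp => hx p hp
    change eval x (detProd K r n * a) = 0
    rw [map_mul]
    by_cases hfx : eval x (detProd K r n) = 0
    · rw [hfx, zero_mul]
    -- a point of `Y` with all `Cᵢ` invertible
    have hgen : ∀ g ∈ fibreGens T e, eval x g = 0 := fun g hg => hx' g (hJ (Ideal.subset_span hg))
    have hdet : ∀ i, (pointMatrix x i).det ≠ 0 := by
      rw [eval_detProd] at hfx
      exact fun i => (Finset.prod_ne_zero_iff.1 hfx) i (Finset.mem_univ i)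
    obtain ⟨D₀, W, hDW⟩ := hrig (pointMatrix x) hdet (prod_pointMatrix_eq_smul T hT e x hgen hfx)
    have hxeval : x = fun v => (D₀ * (W v.1 : Matrix (Fin n) (Fin n) K)) v.2.1 v.2.2 := by
      funext v
      rw [← hDW v.1]
      rfl
    have key := RingHom.congr_fun (eval_gpoint_comp_comorph T D₀ W) a
    rw [RingHom.comp_apply, RingHom.coe_coe, ha, map_zero, ← hxeval] at key
    rw [← key, mul_zero]
  exact (hP'.mem_or_mem hfa).resolve_left hf

include hrig in
/-- Hence `ker φ*` is a (the) minimal prime of the ideal `(fibreGens)` of `n² - 1` equations.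
[folklore] -/
theorem ker_comorph_mem_minimalPrimes [DecidableEq (TuplePoly K r n)]
    (hT : (List.ofFn T).prod = 1) (e : Fin n) :
    RingHom.ker (comorph T) ∈
      (Ideal.span (fibreGens T e : Set (TuplePoly K r n))).minimalPrimes := by
  refine ⟨⟨RingHom.ker_isPrime _, span_fibreGens_le_ker T hT e⟩, ?_⟩
  rintro P' ⟨hP', hJ⟩ hle
  haveI := hP'
  exact ker_comorph_le T hrig hT e hJ fun h => detProd_not_mem_ker T (hle h)

include hrig in
/-- **The dimension count** ([Haraoka2020, Thm. 7.8, third part]; [StrambachVolklein1999]): if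
the tuple `T` with `∏ᵢ Tᵢ = 1` is rigid in the matrix sense then
`r n² ≤ (n² - 1) + (n² + Σᵢ dim C(Tᵢ))`: `dim K[x]/ker φ* ≥ r n² - (n² - 1)` by Krull's height
theorem and the dimension formula, and `dim K[x]/ker φ* ≤ dim K[d, z] = n² + Σᵢ cᵢ` since
`K[x]/ker φ* ↪ K[d, z]`. [cite: Haraoka2020, Theorem 7.8] -/
theorem dim_count (hT : (List.ofFn T).prod = 1) (e : Fin n) :
    r * (n * n) + 1 ≤ n * n + (n * n + ∑ i, cdim T i) := by
  classical
  set P : Ideal (TuplePoly K r n) := RingHom.ker (comorph T) with hPdef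
  haveI hP : P.IsPrime := RingHom.ker_isPrime _
  haveI : IsDomain (TuplePoly K r n ⧸ P) := Ideal.Quotient.isDomain P
  -- Krull: `height P ≤ n² - 1`
  have hKrull := Ideal.height_le_card_of_mem_minimalPrimes_span_finset
    (ker_comorph_mem_minimalPrimes T hrig hT e)
  have hcard := card_fibreGens_le T e
  -- the dimension formula and the two dimensions
  have hformula := Literature.RingTheory.KrullDimension.ringKrullDim_quotient_add_height K P
  rw [ringKrullDim_tuplePoly] at hformula
  have hupper : ringKrullDim (TuplePoly K r n ⧸ P) ≤ ringKrullDim (GroupPoly T) :=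
    Literature.RingTheory.KrullDimension.ringKrullDim_le_of_injective K
      (Ideal.kerLiftAlg (comorph T)) (Ideal.kerLiftAlg_injective _)
  rw [ringKrullDim_groupPoly] at hupper
  obtain ⟨d, hd, -⟩ :=
    Literature.RingTheory.KrullDimension.exists_ringKrullDim_eq_and_trdeg_eq K (TuplePoly K r n ⧸ P)
  rw [hd] at hformula hupper
  have hfin : P.height ≠ ⊤ := ne_top_of_le_ne_top (ENat.coe_ne_top _) hKrull
  obtain ⟨h, hh⟩ := ENat.ne_top_iff_exists.1 hfin
  rw [← hh] at hformula hKrull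
  have h1 : d + h = r * (n * n) := by
    have : ((d + h : ℕ) : WithBot ℕ∞) = (r * (n * n) : ℕ) := by
      rw [← hformula]; rfl
    exact_mod_cast this
  have h2 : d ≤ n * n + ∑ i, cdim T i := by exact_mod_cast hupper
  have h3 : h ≤ n * n - 1 := (by exact_mod_cast hKrull : h ≤ _).trans hcard
  have hn : 1 ≤ n * n := Nat.one_le_iff_ne_zero.2 (Nat.mul_ne_zero e.pos.ne' e.pos.ne')
  omega

end Rigid

end RigidTuple

end Literature.AlgebraicGeometry.Motives

end
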